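import Summits.QuantumFields.YangMills.Theorems.ParabolicTrajectoryLatticeGapOnTrajectorySparseDefectDefs
import HarnessLib

/-!
# Crux `LatticeGapOnTrajectory` (stmt-QuantumFields-10523), line `sparse-defect-orbit-window`
# (`SketchIdeator5-r2`): the plumbing stub `stub_decayOfTypicalWindows`

`SparseDefectEngine → WilsonTorusDLR r → TypicalOrbitWindowsAlongP r M sch n → CellDecayAlongP r M sch n`
(G-blind plumbing, modelled on `cellDecayAlongP_of_windowsP`): the annealed engine at `(n₀, γ₀, 1)` supplies
`(κ, C₀, c₀)`; since `ε_k (1 + A_k) → 0`, eventually `ε_k (1 + A_k) ≤ c₀`, and on that tail the engine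
applies torus by torus and frame family by frame family to Wilson's torus specification (a specification
with Wilson's torus measure as a Gibbs measure, `WilsonTorusDLR`) under the typical window package.
-/

set_option autoImplicit false

noncomputable section

namespace Summit.QuantumFields.YangMills.Cruxes.LatticeGapOnTrajectory.SparseDefectOrbitWindow

open scoped BigOperators Topology ENNReal ProbabilityTheory
open Filter MeasureTheory
open Literature.Probability.LatticeModels (Specification IsSpecification IsGibbsMeasure glueWith)
open Literature.MathematicalPhysics.QuantumFieldTheory
open Summit.QuantumFields.YangMills.Theses.ParabolicTrajectory
open Summit.QuantumFields.YangMills.Cruxes.LatticeGapOnTrajectory.OrbitKantorovichFiniteSize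

/-- **stub_decayOfTypicalWindows** — G-blind plumbing: the engine (with its threshold `c₀(n₀, γ₀, 1)`), the DLR
description of Wilson's torus measure and the typical package along the scheme (`ε_k (1 + A_k) → 0`, so eventually
`ε_k (1 + A_k) ≤ c₀`) give the decay package `CellDecayAlongP` with `(κ, C₀) = engine(n₀, γ₀, 1)`. -/
theorem stub_decayOfTypicalWindows :
    ∀ (G : Type) [Group G] [TopologicalSpace G] [IsTopologicalGroup G] [CompactSpace G]
      [MeasurableSpace G] [BorelSpace G] (r : LatticeRep G) (M : ℕ) (sch : SpeciesScheme (YMSpecies G))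
      (n : ℕ → ℕ), SparseDefectEngine → WilsonTorusDLR r → TypicalOrbitWindowsAlongP r M sch n →
        CellDecayAlongP r M sch n := by
  intro G _ _ _ _ _ _ r M sch n hE hDLR hT
  obtain ⟨t, n₀, γ₀, α, A, ε, K, ht, hγ₀, hγ₁, hα, hε, hsmall, hP, hrest⟩ := hT
  obtain ⟨κ, C₀, c₀, hκ, hC₀, hc₀, hEng⟩ := hE n₀ γ₀ 1 hγ₀ hγ₁ zero_le_one
  have hev : ∀ᶠ k in atTop, ε k * (1 + A k) ≤ c₀ :=
    (hsmall.eventually (gt_mem_nhds hc₀)).mono fun _ hk => hk.le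
  refine ⟨t, n₀, κ, C₀, α, K, ht, hκ, hC₀, hα, hP, fun s => ?_⟩
  filter_upwards [hrest s, hev] with k hk hk' S hS μ q hμ hframe
  obtain ⟨⟨kp, good, hW, hH, hS'⟩, hRC⟩ := hk S hS μ q hμ hframe
  obtain ⟨hγ, hGibbs⟩ := hDLR (sch.β k) (2 * S + 1)
  exact ⟨fun f g Δf Δg δf δg D hf hg hfb hgb hfd hgd hLf hLg hD =>
    hEng (A k) (ε k) (hε k) hk' μ _ _ (cellOf q) (orbitWeight r (α k) q)
      (torusYM r.ρ (sch.β k) (2 * S + 1)) kp good hμ hγ hW hH _ hGibbs hS' f g Δf Δg δf δg D hf hg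
      hfb hgb hfd hgd hLf hLg hD, hRC⟩

end Summit.QuantumFields.YangMills.Cruxes.LatticeGapOnTrajectory.SparseDefectOrbitWindow

end
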